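import Literature.Computability.Learning.AmpPEvalFP
import Literature.Computability.Learning.AmpPRun
import Literature.Computability.Complexity.CodeFPListKit
import HarnessLib

/-!
# The von Neumann stage of the `AC⁰[p]` learner's hypothesis in `FP`

Machine-layer groundwork for the named fact `Literature.Computability.Learning.cikk_learn_AC0Mod`
(CIKK 2016, Cor. 5.4): the predictor `vnPred` of `VonNeumannPredictor.lean` (CIKK Thm. 4.7,
constructive direction) — `C(σ) = u` if `h₁(w[m ↦ σ]) = E^{vN}(hyb_m[m ↦ u])`, else `u'` — as a
string function, for an arbitrary predictor string function `H` (the learner uses the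
table-based NW predictor `ColDesign.predFn`). On `⟨V, σbits⟩`,
`V = ⟨P, ⟨1^m, ⟨wblk, ⟨labR, ⟨labA, ⟨u, u'⟩⟩⟩⟩⟩⟩` (predictor record, hybrid index, the `2T`
filler blocks as ONE input string, the real labels `G(w_c)` precomputed from the answers, the
ideal labels, the guessed and the fallback value; field elements as binary numerals `< p`):

* `blockBits`, `inputBits` (the bits of an ideal block / input in the layout `ampPIdxEquiv`),
  `chunk_inputBits`, `inputBits_eq_flatten`, `spliceN_inputBits` (replacing block `m`);
* the numeric recipe `vnPredN H V σbits` and its code `vnPred_codeFP` (for `H ∈ FP`), the string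
  function `vnPredFn H` (`∈ FP`, `vnPredFn_apply`);
* **`vnPredN_eq`** — on the genuine record `vnRecOf` of the coins `c = (m, w, a, u, u')` and a
  predictor string function realising `h₁`, the value is `(vnPred G (idealPred h₁) c σ).val`.

## References

* M. Carmosino, R. Impagliazzo, V. Kabanets, A. Kolokolova, *Learning algorithms from natural
  proofs*, CCC 2016, Def. 4.5, Thm. 4.7 (proof: the reverse, algorithmic direction)
  [CarmosinoImpagliazzoKabanetsKolokolova2016].
* S. Arora, B. Barak, *Computational Complexity: A Modern Approach*, CUP 2009, §1.3 [AroraBarak2009].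
-/

open Polynomial

namespace Literature.Computability.Learning

open Literature.Computability.Complexity Literature.Computability.Complexity.Brick
  Literature.Computability.Complexity.Plumb Literature.Computability.MetaComplexity
  Literature.Computability.Cryptography _root_.Computability Finset CodeFP

variable {p : ℕ} [hp : Fact p.Prime] {n k β T : ℕ}

/-! ### Block bits and input bits -/

/-- The layout of one block: points first, then positions. [folklore] -/
def innerEquiv (n k β : ℕ) : (Fin k × Fin n) ⊕ (Fin k × Fin β) ≃ Fin (k * n + k * β) :=
  (finProdFinEquiv.sumCongr finProdFinEquiv).trans finSumFinEquiv

omit hp in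
/-- `ampPIdxEquiv` is the block layout inside `finProdFinEquiv`. [folklore] -/
theorem ampPIdxEquiv_eq (q : AmpPIdx n k β T) :
    ampPIdxEquiv n k β T q = finProdFinEquiv (q.1, innerEquiv n k β q.2) := rfl

/-- A bit of a bit block. [folklore] -/
def blkBit (b : Blk n k β) : (Fin k × Fin n) ⊕ (Fin k × Fin β) → Bool
  | Sum.inl (i, j) => b.1 i j
  | Sum.inr (i, e) => b.2 i e

omit hp in
/-- `blkOf` and `blkBit` are inverse. [folklore] -/
theorem blkBit_blkOf (w : AmpPIdx n k β T → Bool) (c : Fin (T * 2)) (s : (Fin k × Fin n) ⊕ (Fin k × Fin β)) :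
    blkBit (blkOf w c) s = w (c, s) := by
  rcases s with ⟨i, j⟩ | ⟨i, e⟩ <;> rfl

/-- The bits of a block in the block layout. [folklore] -/
def blockBits (b : Blk n k β) : List Bool := List.ofFn fun r => blkBit b ((innerEquiv n k β).symm r)

omit hp in
/-- A block has `kn + kβ` bits. [folklore] -/
@[simp] theorem length_blockBits (b : Blk n k β) : (blockBits b).length = k * n + k * β := by simp [blockBits]

/-- The input string of a tuple of ideal blocks (the layout `ampPIdxEquiv`). [folklore] -/
def inputBits (w : Fin (T * 2) → SBlk n k p β) : List Bool := List.ofFn (encode w ∘ (ampPIdxEquiv n k β T).symm)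

/-- An input has `2T(kn + kβ)` bits. [folklore] -/
@[simp] theorem length_inputBits (w : Fin (T * 2) → SBlk n k p β) : (inputBits w).length = T * 2 * (k * n + k * β) := by
  simp [inputBits]

/-- `encode` reads the bit blocks. [folklore] -/
theorem encode_apply (w : Fin (T * 2) → SBlk n k p β) (c : Fin (T * 2)) (s : (Fin k × Fin n) ⊕ (Fin k × Fin β)) :
    encode w (c, s) = blkBit (encBlk (w c)) s := by
  rcases s with ⟨i, j⟩ | ⟨i, e⟩ <;> rfl

/-- **Block `c` of the input string is the bit block of `w c`.** [folklore] -/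
theorem chunk_inputBits (w : Fin (T * 2) → SBlk n k p β) (c : Fin (T * 2)) :
    ((inputBits w).drop (c * (k * n + k * β))).take (k * n + k * β) = blockBits (encBlk (w c)) := by
  set Bl := k * n + k * β with hBl
  have hc1 : (c : ℕ) + 1 ≤ T * 2 := c.isLt
  have hcB : ((c : ℕ) + 1) * Bl ≤ T * 2 * Bl := Nat.mul_le_mul_right Bl hc1
  apply List.ext_getElem
  · simp only [List.length_take, List.length_drop, length_inputBits, length_blockBits]
    rw [add_mul, one_mul] at hcB
    rw [← hBl]
    omega
  · intro d h1 h2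
    rw [length_blockBits] at h2
    have hlt : (c : ℕ) * Bl + d < T * 2 * (k * n + k * β) := by rw [add_mul, one_mul] at hcB; rw [← hBl]; omega
    simp only [inputBits, blockBits, List.getElem_take, List.getElem_drop, List.getElem_ofFn, Function.comp_apply]
    have hidx : (ampPIdxEquiv n k β T).symm (⟨(c : ℕ) * Bl + d, hlt⟩ : Fin (T * 2 * (k * n + k * β))) =
        (c, (innerEquiv n k β).symm ⟨d, h2⟩) := by
      rw [Equiv.symm_apply_eq, ampPIdxEquiv_eq]
      apply Fin.ext
      simp [finProdFinEquiv, hBl]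
      ring
    rw [hidx, encode_apply]

omit hp in
/-- A string of length `N · Bl` is the concatenation of its `N` chunks of length `Bl`. [folklore] -/
theorem flatten_chunks (Bl : ℕ) : ∀ (N : ℕ) (l : List Bool), l.length = N * Bl →
    ((List.range N).map fun c => (l.drop (c * Bl)).take Bl).flatten = l
  | 0, l, h => by
      rw [zero_mul, List.length_eq_zero_iff] at h
      subst h; rfl
  | N + 1, l, h => by
      rw [List.range_succ, List.map_append, List.flatten_append, List.map_singleton, List.flatten_singleton]
      have hlen : (l.take (N * Bl)).length = N * Bl := by
        rw [List.length_take, min_eq_left]; rw [h]; exact Nat.mul_le_mul_right Bl (Nat.le_succ N)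
      have hfirst : ((List.range N).map fun c => (l.drop (c * Bl)).take Bl) =
          (List.range N).map fun c => ((l.take (N * Bl)).drop (c * Bl)).take Bl := by
        refine List.map_congr_left fun c hc => ?_
        rw [List.mem_range] at hc
        rw [List.drop_take, List.take_take, min_eq_left]
        have : (c + 1) * Bl ≤ N * Bl := Nat.mul_le_mul_right Bl hc
        rw [add_mul, one_mul] at this
        omega
      rw [hfirst, flatten_chunks Bl N (l.take (N * Bl)) hlen,
        List.take_of_length_le (l := l.drop (N * Bl)) (by rw [List.length_drop, h, Nat.succ_mul]; omega), List.take_append_drop]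

/-- **The input string is the concatenation of the bit blocks.** [folklore] -/
theorem inputBits_eq_flatten (w : Fin (T * 2) → SBlk n k p β) :
    inputBits w = (List.ofFn fun c : Fin (T * 2) => blockBits (encBlk (w c))).flatten := by
  conv_lhs => rw [← flatten_chunks (k * n + k * β) (T * 2) (inputBits w) (length_inputBits w)]
  rw [map_range_eq_ofFn]
  congr 1
  exact congrArg List.ofFn (funext fun c => chunk_inputBits w c)

/-- Replacing block `m` of a chunked string. [folklore] -/
def spliceN (Bl m : ℕ) (wblk σbits : List Bool) (N : ℕ) : List Bool :=
  ((List.range N).map fun c => if c = m then σbits else (wblk.drop (c * Bl)).take Bl).flatten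

/-- **Splicing the bits of `σ` at block `m` gives the input string of `w[m ↦ σ]`.** [folklore] -/
theorem spliceN_inputBits (w : Fin (T * 2) → SBlk n k p β) (m : Fin (T * 2)) (σ : SBlk n k p β) :
    spliceN (k * n + k * β) m (inputBits w) (blockBits (encBlk σ)) (T * 2) = inputBits (Function.update w m σ) := by
  rw [spliceN, map_range_eq_ofFn, inputBits_eq_flatten (Function.update w m σ)]
  congr 1
  refine congrArg List.ofFn (funext fun c => ?_)
  by_cases hc : c = m
  · subst hc; simp
  · have hc' : (c : ℕ) ≠ m := fun h => hc (Fin.ext h)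
    rw [if_neg hc', chunk_inputBits, Function.update_of_ne hc]

/-! ### Labels and pairs -/

/-- The hybrid labels with `u` at coordinate `m`, from the stored real and ideal labels. [folklore] -/
def labN (m u : ℕ) (labR labA : List ℕ) : List ℕ :=
  (List.range labA.length).map fun c => if c < m then labR.getD c 0 else if c = m then u else labA.getD c 0

/-- The `T` pairs `(l_{2j}, l_{2j+1})`. [folklore] -/
def pairsN (l : List ℕ) (T : ℕ) : List (ℕ × ℕ) := (List.range T).map fun j => (l.getD (2 * j) 0, l.getD (2 * j + 1) 0)

omit hp in
/-- **The stored labels give `hyb_m[m ↦ u]`** (through `val`). [cite: CarmosinoImpagliazzoKabanetsKolokolova2016, Thm. 4.7 (proof)] -/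
theorem labN_eq (G : SBlk n k p β → ZMod p) (m : Fin (T * 2)) (w : Fin (T * 2) → SBlk n k p β)
    (a : Fin (T * 2) → ZMod p) (u : ZMod p) :
    labN m u.val (List.ofFn fun c => (G (w c)).val) (List.ofFn fun c => (a c).val) =
      List.ofFn fun c : Fin (T * 2) => (Function.update (hybLab G m w a) m u c).val := by
  rw [labN, List.length_ofFn, map_range_eq_ofFn]
  refine congrArg List.ofFn (funext fun c => ?_)
  by_cases hcm : c = m
  · subst hcm; simp
  · have hc' : (c : ℕ) ≠ m := fun h => hcm (Fin.ext h)
    rw [Function.update_of_ne hcm]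
    simp only [hc', if_false, hybLab]
    by_cases hlt : (c : ℕ) < m
    · rw [if_pos hlt, if_pos hlt, List.getD_eq_getElem _ _ (by simp), List.getElem_ofFn]
    · rw [if_neg hlt, if_neg hlt, List.getD_eq_getElem _ _ (by simp), List.getElem_ofFn]

omit hp in
/-- **The pairs of the label string are the pairs of `pairUp`** (through `val`). [folklore] -/
theorem pairsN_eq (L : Fin (T * 2) → ZMod p) :
    pairsN (List.ofFn fun c => (L c).val) T = (List.ofFn (pairUp T L)).map fun ab => (ab.1.val, ab.2.val) := by
  rw [pairsN, map_range_eq_ofFn, List.map_ofFn]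
  refine congrArg List.ofFn (funext fun j => ?_)
  have h0 : ((finProdFinEquiv (j, (0 : Fin 2)) : Fin (T * 2)) : ℕ) = 2 * j := by simp [finProdFinEquiv]
  have h1 : ((finProdFinEquiv (j, (1 : Fin 2)) : Fin (T * 2)) : ℕ) = 2 * j + 1 := by simp [finProdFinEquiv, add_comm]
  have hl0 : 2 * (j : ℕ) < T * 2 := by rw [← h0]; exact Fin.isLt _
  have hl1 : 2 * (j : ℕ) + 1 < T * 2 := by rw [← h1]; exact Fin.isLt _
  simp only [Function.comp_apply, pairUp_apply]
  rw [List.getD_eq_getElem _ _ (by simpa using hl0), List.getD_eq_getElem _ _ (by simpa using hl1), List.getElem_ofFn,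
    List.getElem_ofFn]
  congr 2 <;> congr 1 <;> apply Fin.ext <;> simp [h0, h1]

/-! ### The numeric recipe and its correctness -/

/-- The typed vN record `⟨P, ⟨1^m, ⟨wblk, ⟨labR, ⟨labA, ⟨u, u'⟩⟩⟩⟩⟩⟩`. [folklore] -/
abbrev VnRecT : Type := List Bool × (ℕ × (List Bool × (List ℕ × (List ℕ × (ℕ × ℕ)))))

/-- **The recipe of the vN stage**: splice `σ` at block `m`, ask the predictor, compare with
`E^{vN}` of the labels, answer `u` or `u'`. [cite: CarmosinoImpagliazzoKabanetsKolokolova2016, Thm. 4.7 (proof)] -/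
def vnPredN (H : List Bool → List Bool) (V : VnRecT) (σbits : List Bool) : ℕ :=
  if (H (boolPair V.1 (spliceN σbits.length V.2.1 V.2.2.1 σbits V.2.2.2.2.1.length))).headD false =
      vnLN (pairsN (labN V.2.1 V.2.2.2.2.2.1 V.2.2.2.1 V.2.2.2.2.1) (V.2.2.2.2.1.length / 2))
  then V.2.2.2.2.2.1 else V.2.2.2.2.2.2

/-- **The genuine vN record** of the predictor record `P` and the coins `c = (m, w, a, u, u')`, the
real labels `G(w_c)` precomputed. [cite: CarmosinoImpagliazzoKabanetsKolokolova2016, Thm. 4.7 (proof)] -/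
def vnRecOf (P : List Bool) (G : SBlk n k p β → ZMod p) (c : VNCoins (SBlk n k p β) T p) : VnRecT :=
  (P, ((c.1 : ℕ), (inputBits c.2.1, (List.ofFn fun d => (G (c.2.1 d)).val,
    (List.ofFn fun d => (c.2.2.1 d).val, ((c.2.2.2.1).val, (c.2.2.2.2).val))))))

/-- **The recipe computes `vnPred`** on the genuine record, for a predictor string function `H`
realising `h₁` on the record `P`. [cite: CarmosinoImpagliazzoKabanetsKolokolova2016, Thm. 4.7] -/
theorem vnPredN_eq (H : List Bool → List Bool) (P : List Bool) (h₁ : (Fin (T * 2 * (k * n + k * β)) → Bool) → Bool)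
    (hH : ∀ x : Fin (T * 2 * (k * n + k * β)) → Bool, H (boolPair P (List.ofFn x)) = [h₁ x])
    (G : SBlk n k p β → ZMod p) (c : VNCoins (SBlk n k p β) T p) (σ : SBlk n k p β) :
    vnPredN H (vnRecOf P G c) (blockBits (encBlk σ)) = (vnPred G (idealPred h₁) c σ).val := by
  obtain ⟨m, w, a, u, u'⟩ := c
  have hin : spliceN (blockBits (encBlk σ)).length m (inputBits w) (blockBits (encBlk σ))
      (List.ofFn fun d => (a d).val).length = List.ofFn (encode (Function.update w m σ) ∘ (ampPIdxEquiv n k β T).symm) := by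
    rw [length_blockBits, List.length_ofFn, spliceN_inputBits]; rfl
  have hb : (H (boolPair P (spliceN (blockBits (encBlk σ)).length m (inputBits w) (blockBits (encBlk σ))
      (List.ofFn fun d => (a d).val).length))).headD false = idealPred h₁ (Function.update w m σ) := by
    rw [hin, hH]; rfl
  have he : vnLN (pairsN (labN m u.val (List.ofFn fun d => (G (w d)).val) (List.ofFn fun d => (a d).val))
      ((List.ofFn fun d => (a d).val).length / 2)) = vnE2 T (Function.update (hybLab G m w a) m u) := by
    rw [List.length_ofFn, Nat.mul_div_cancel _ (by norm_num : 0 < 2), labN_eq, pairsN_eq, vnLN_map_val]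
    rfl
  unfold vnPredN vnRecOf
  simp only
  rw [hb, he, vnPred, vnTest]
  simp only
  by_cases h : idealPred h₁ (Function.update w m σ) = vnE2 T (Function.update (hybLab G m w a) m u)
  · rw [if_pos h, decide_eq_true h]; rfl
  · rw [if_neg h, decide_eq_false h]; rfl

/-! ### The recipe as a polynomial-time code -/

/-- The code of the vN record. [folklore] -/
abbrev vnRecE : VnRecT → List Bool :=
  pairE strE (pairE unE (pairE strE (pairE (rawE natE) (pairE (rawE natE) (pairE natE natE)))))

/-- The code of the argument `⟨V, σbits⟩`. [folklore] -/
abbrev vnArgE : VnRecT × List Bool → List Bool := pairE vnRecE strE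

/-- `spliceN` is a code (context `(1^{Bl}, (1^m, (wblk, σbits)))`, item count in unary). [folklore] -/
theorem splice_codeFP : CodeFP (pairE (pairE unE (pairE unE (pairE strE strE))) unE) strE
    (fun q => spliceN q.1.1 q.1.2.1 q.1.2.2.1 q.1.2.2.2 q.2) := by
  let ρ : Type := (ℕ × (ℕ × (List Bool × List Bool))) × ℕ
  let eρ : ρ → List Bool := pairE (pairE unE (pairE unE (pairE strE strE))) unE
  -- the chunk at index `c`
  have hB : CodeFP (pairE eρ natE) natE (fun t => t.1.1.1) := (natOfUn.comp (fst _ _).fst'.fst').congr fun _ => rfl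
  have hBU : CodeFP (pairE eρ natE) unE (fun t => t.1.1.1) := (fst _ _).fst'.fst'
  have hm : CodeFP (pairE eρ natE) natE (fun t => t.1.1.2.1) := (natOfUn.comp (fst _ _).fst'.snd'.fst').congr fun _ => rfl
  have hw : CodeFP (pairE eρ natE) strE (fun t => t.1.1.2.2.1) := (fst _ _).fst'.snd'.snd'.fst'
  have hσ : CodeFP (pairE eρ natE) strE (fun t => t.1.1.2.2.2) := (fst _ _).fst'.snd'.snd'.snd'
  have hc : CodeFP (pairE eρ natE) natE (fun t => t.2) := snd _ _
  have hwL : CodeFP (pairE eρ natE) unE (fun t => t.1.1.2.2.1.length) := strLength.comp hw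
  have hoff : CodeFP (pairE eρ natE) unE (fun t => min (t.2 * t.1.1.1) t.1.1.2.2.1.length) :=
    (unOfNatMin.comp (hwL.pair (natMul.comp (hc.pair hB)))).congr fun _ => rfl
  have hchunk : CodeFP (pairE eρ natE) strE (fun t => (t.1.1.2.2.1.drop (t.2 * t.1.1.1)).take t.1.1.1) :=
    (strTake.comp (hBU.pair (strDrop.comp (hoff.pair hw)))).congr fun t => by
      congr 1
      by_cases h : t.2 * t.1.1.1 ≤ t.1.1.2.2.1.length
      · rw [min_eq_left h]
      · rw [min_eq_right (le_of_not_ge h), List.drop_length, List.drop_eq_nil_of_le (le_of_not_ge h)]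
  have hitem : CodeFP (pairE eρ natE) strE (fun t => if decide (t.2 = t.1.1.2.1) then t.1.1.2.2.2 else
      (t.1.1.2.2.1.drop (t.2 * t.1.1.1)).take t.1.1.1) :=
    ((natEq.comp (hc.pair hm)).congr fun _ => rfl).ite hσ hchunk
  have hrange : CodeFP eρ (rawE natE) (fun q => List.range q.2) := urange.comp (snd _ _)
  have hmap := (CodeFP.map hitem).comp ((CodeFP.id eρ).pair hrange)
  exact (strFlatten.comp hmap).congr fun q => by simp [spliceN, id]

/-- `labN` is a code. [folklore] -/
theorem labN_codeFP : CodeFP (pairE natE (pairE natE (pairE (rawE natE) (rawE natE)))) (rawE natE)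
    (fun q => labN q.1 q.2.1 q.2.2.1 q.2.2.2) := by
  let ρ : Type := ℕ × (ℕ × (List ℕ × List ℕ))
  let eρ : ρ → List Bool := pairE natE (pairE natE (pairE (rawE natE) (rawE natE)))
  have hm : CodeFP (pairE eρ natE) natE (fun t => t.1.1) := (fst _ _).fst'
  have hu : CodeFP (pairE eρ natE) natE (fun t => t.1.2.1) := (fst _ _).snd'.fst'
  have hR : CodeFP (pairE eρ natE) (rawE natE) (fun t => t.1.2.2.1) := (fst _ _).snd'.snd'.fst'
  have hA : CodeFP (pairE eρ natE) (rawE natE) (fun t => t.1.2.2.2) := (fst _ _).snd'.snd'.snd'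
  have hc : CodeFP (pairE eρ natE) natE (fun t => t.2) := snd _ _
  have hgetR : CodeFP (pairE eρ natE) natE (fun t => t.1.2.2.1.getD t.2 0) :=
    ((rawGetOr natE).comp (hR.pair (hc.pair (const _ 0)))).congr fun _ => rfl
  have hgetA : CodeFP (pairE eρ natE) natE (fun t => t.1.2.2.2.getD t.2 0) :=
    ((rawGetOr natE).comp (hA.pair (hc.pair (const _ 0)))).congr fun _ => rfl
  have hitem : CodeFP (pairE eρ natE) natE (fun t => if decide (t.2 < t.1.1) then t.1.2.2.1.getD t.2 0 else
      if decide (t.2 = t.1.1) then t.1.2.1 else t.1.2.2.2.getD t.2 0) :=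
    ((natLt.comp (hc.pair hm)).congr fun _ => rfl).ite hgetR (((natEq.comp (hc.pair hm)).congr fun _ => rfl).ite hu hgetA)
  have hrange : CodeFP eρ (rawE natE) (fun q => List.range q.2.2.2.length) :=
    (urange.comp ((ulength natE).comp (snd _ _).snd'.snd')).congr fun _ => rfl
  exact ((CodeFP.map hitem).comp ((CodeFP.id eρ).pair hrange)).congr fun q => by simp [labN, id]

/-- `pairsN` is a code. [folklore] -/
theorem pairsN_codeFP : CodeFP (pairE (rawE natE) unE) (rawE (pairE natE natE)) (fun q => pairsN q.1 q.2) := by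
  have hl : CodeFP (pairE (pairE (rawE natE) unE) natE) (rawE natE) (fun t => t.1.1) := (fst _ _).fst'
  have hj : CodeFP (pairE (pairE (rawE natE) unE) natE) natE (fun t => t.2) := snd _ _
  have h2j : CodeFP (pairE (pairE (rawE natE) unE) natE) natE (fun t => 2 * t.2) := (natMul.comp ((const _ 2).pair hj)).congr fun _ => rfl
  have h2j1 : CodeFP (pairE (pairE (rawE natE) unE) natE) natE (fun t => 2 * t.2 + 1) :=
    (natAdd.comp (h2j.pair (const _ 1))).congr fun _ => rfl
  have hitem : CodeFP (pairE (pairE (rawE natE) unE) natE) (pairE natE natE)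
      (fun t => (t.1.1.getD (2 * t.2) 0, t.1.1.getD (2 * t.2 + 1) 0)) :=
    (((rawGetOr natE).comp (hl.pair (h2j.pair (const _ 0)))).pair ((rawGetOr natE).comp (hl.pair (h2j1.pair (const _ 0))))).congr
      fun _ => rfl
  have hrange : CodeFP (pairE (rawE natE) unE) (rawE natE) (fun q => List.range q.2) := urange.comp (snd _ _)
  exact ((CodeFP.map hitem).comp ((CodeFP.id _).pair hrange)).congr fun q => by simp [pairsN, id]

/-- `vnLN` is a code. [folklore] -/
theorem vnLN_codeFP : CodeFP (rawE (pairE natE natE)) bitE vnLN := by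
  have hfold : CodeFP (rawE (pairE natE natE)) natE (fun l => l.foldl (fun s ab => vnStepN ab s) 0) :=
    foldl₀ (step := fun ab s => vnStepN ab s) (b₀ := 0) vnStepN_codeFP (C 2) fun l₁ l₂ => by
      rw [eval_C]
      exact (length_natE_le _).trans (foldl_vnStepN_le l₁ (by norm_num))
  exact ((natEq.comp (hfold.pair (const _ 1))).not).congr fun l => by simp [vnLN]

/-- **The predictor's argument** `⟨P, spliced input⟩` is a code of the vN argument. [folklore] -/
theorem vnPre_codeFP : CodeFP vnArgE (pairE strE strE)
    (fun a => (a.1.1, spliceN a.2.length a.1.2.1 a.1.2.2.1 a.2 a.1.2.2.2.2.1.length)) := by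
  have hP : CodeFP vnArgE strE (fun a => a.1.1) := (fst _ _).fst'
  have hm : CodeFP vnArgE unE (fun a => a.1.2.1) := (fst _ _).snd'.fst'
  have hw : CodeFP vnArgE strE (fun a => a.1.2.2.1) := (fst _ _).snd'.snd'.fst'
  have hA : CodeFP vnArgE (rawE natE) (fun a => a.1.2.2.2.2.1) := (fst _ _).snd'.snd'.snd'.snd'.fst'
  have hσ : CodeFP vnArgE strE (fun a => a.2) := snd _ _
  have hBl : CodeFP vnArgE unE (fun a => a.2.length) := strLength.comp hσ
  have hN : CodeFP vnArgE unE (fun a => a.1.2.2.2.2.1.length) := (ulength natE).comp hA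
  exact (hP.pair (splice_codeFP.comp ((hBl.pair (hm.pair (hw.pair hσ))).pair hN))).congr fun _ => rfl

/-- **The answer** from the vN argument and the predictor's output string. [folklore] -/
theorem vnPost_codeFP : CodeFP (pairE vnArgE strE) natE
    (fun q => if q.2.headD false = vnLN (pairsN (labN q.1.1.2.1 q.1.1.2.2.2.2.2.1 q.1.1.2.2.2.1 q.1.1.2.2.2.2.1)
      (q.1.1.2.2.2.2.1.length / 2)) then q.1.1.2.2.2.2.2.1 else q.1.1.2.2.2.2.2.2) := by
  have hV : CodeFP (pairE vnArgE strE) vnRecE (fun q => q.1.1) := (fst _ _).fst'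
  have hm : CodeFP (pairE vnArgE strE) natE (fun q => q.1.1.2.1) := (natOfUn.comp hV.snd'.fst').congr fun _ => rfl
  have hR : CodeFP (pairE vnArgE strE) (rawE natE) (fun q => q.1.1.2.2.2.1) := hV.snd'.snd'.snd'.fst'
  have hA : CodeFP (pairE vnArgE strE) (rawE natE) (fun q => q.1.1.2.2.2.2.1) := hV.snd'.snd'.snd'.snd'.fst'
  have hu : CodeFP (pairE vnArgE strE) natE (fun q => q.1.1.2.2.2.2.2.1) := hV.snd'.snd'.snd'.snd'.snd'.fst'
  have hu' : CodeFP (pairE vnArgE strE) natE (fun q => q.1.1.2.2.2.2.2.2) := hV.snd'.snd'.snd'.snd'.snd'.snd'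
  have hb : CodeFP (pairE vnArgE strE) bitE (fun q => q.2.headD false) :=
    (strGetD.comp ((const _ 0).pair (snd _ _))).congr fun q => by
      rcases q with ⟨V, _ | ⟨b, l⟩⟩ <;> rfl
  have hT : CodeFP (pairE vnArgE strE) unE (fun q => q.1.1.2.2.2.2.1.length / 2) := by
    have h := unOfNatMin.comp (((ulength natE).comp hA).pair (natDiv.comp (((natLength natE).comp hA).pair (const _ 2))))
    exact h.congr fun q => min_eq_left (Nat.div_le_self _ _)
  have he : CodeFP (pairE vnArgE strE) bitE (fun q => vnLN (pairsN (labN q.1.1.2.1 q.1.1.2.2.2.2.2.1 q.1.1.2.2.2.1 q.1.1.2.2.2.2.1)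
      (q.1.1.2.2.2.2.1.length / 2))) :=
    (vnLN_codeFP.comp (pairsN_codeFP.comp ((labN_codeFP.comp (hm.pair (hu.pair (hR.pair hA)))).pair hT))).congr fun _ => rfl
  have hcond : CodeFP (pairE vnArgE strE) bitE (fun q => decide (q.2.headD false =
      vnLN (pairsN (labN q.1.1.2.1 q.1.1.2.2.2.2.2.1 q.1.1.2.2.2.1 q.1.1.2.2.2.2.1) (q.1.1.2.2.2.2.1.length / 2)))) :=
    ((eq bitE_injective).comp (hb.pair he)).congr fun _ => rfl
  exact (hcond.ite hu hu').congr fun q => by simp only [decide_eq_true_eq]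

/-- The argument transformer of the vN stage. [folklore] -/
noncomputable def vnPreF : List Bool → List Bool := Classical.choose vnPre_codeFP

/-- The answer function of the vN stage. [folklore] -/
noncomputable def vnPostF : List Bool → List Bool := Classical.choose vnPost_codeFP

/-- **The vN stage as a string function** for the predictor string function `H`: transform the
argument, call `H`, answer. [cite: CarmosinoImpagliazzoKabanetsKolokolova2016, Thm. 4.7 (proof)] -/
noncomputable def vnPredFn (H : List Bool → List Bool) : List Bool → List Bool :=
  vnPostF ∘ fanoutFn id (H ∘ vnPreF)

/-- `vnPredFn H ∈ FP` for `H ∈ FP`. [cite: AroraBarak2009, §1.3] -/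
theorem vnPredFn_mem_FP {H : List Bool → List Bool} (hH : H ∈ FP) : vnPredFn H ∈ FP :=
  comp_mem_FP (Classical.choose_spec vnPost_codeFP).1
    (fanoutFn_mem_FP (PolyTimeComputable.id _) (comp_mem_FP hH (Classical.choose_spec vnPre_codeFP).1))

/-- **Value of `vnPredFn`**: the recipe, as a binary numeral. [folklore] -/
theorem vnPredFn_apply (H : List Bool → List Bool) (V : VnRecT) (σbits : List Bool) :
    vnPredFn H (vnArgE (V, σbits)) = natE (vnPredN H V σbits) := by
  have hpre := (Classical.choose_spec vnPre_codeFP).2 (V, σbits)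
  have hpost := (Classical.choose_spec vnPost_codeFP).2 ((V, σbits), H (boolPair V.1
    (spliceN σbits.length V.2.1 V.2.2.1 σbits V.2.2.2.2.1.length)))
  rw [vnPredFn, Function.comp_apply, fanoutFn_apply, id, Function.comp_apply]
  change vnPostF (boolPair (vnArgE (V, σbits)) (H (vnPreF (vnArgE (V, σbits))))) = _
  rw [show vnPreF (vnArgE (V, σbits)) = boolPair V.1 (spliceN σbits.length V.2.1 V.2.2.1 σbits V.2.2.2.2.1.length) from hpre]
  rw [show boolPair (vnArgE (V, σbits)) (H (boolPair V.1 (spliceN σbits.length V.2.1 V.2.2.1 σbits V.2.2.2.2.1.length))) =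
    pairE vnArgE strE ((V, σbits), H (boolPair V.1 (spliceN σbits.length V.2.1 V.2.2.1 σbits V.2.2.2.2.1.length))) from rfl]
  exact hpost

/-- **The vN stage computes `vnPred`** on the genuine record (the hypothesis of `candVecPFn`'s
bridge): `vnPredFn H ⟨vnRecOf P G c, blockBits σ⟩ = bin (vnPred G (idealPred h₁) c σ).val`.
[cite: CarmosinoImpagliazzoKabanetsKolokolova2016, Thm. 4.7] -/
theorem vnPredFn_apply_genuine (H : List Bool → List Bool) (P : List Bool) (h₁ : (Fin (T * 2 * (k * n + k * β)) → Bool) → Bool)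
    (hH : ∀ x : Fin (T * 2 * (k * n + k * β)) → Bool, H (boolPair P (List.ofFn x)) = [h₁ x])
    (G : SBlk n k p β → ZMod p) (c : VNCoins (SBlk n k p β) T p) (σ : SBlk n k p β) :
    vnPredFn H (vnArgE (vnRecOf P G c, blockBits (encBlk σ))) = natE (vnPred G (idealPred h₁) c σ).val := by
  rw [vnPredFn_apply, vnPredN_eq H P h₁ hH]

end Literature.Computability.Learning
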